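import Summits.HodgeConjecture.HodgeConjecture.Theorems.F0P3cStCharTSTubeJacobianTransport   -- ★ p851876 (Q9): generic transport of the local tube-Jacobian socket + kit
import Literature.NumberTheory.Rogawski1990.RegularOrbitalIntegralLocallyConstantCM        -- ★ `isRegularElt_iff_charpoly_separable_localNonsplitEquiv` (brings ★ `localNonsplitEquiv`)
import Literature.NumberTheory.Rogawski1990.CMLocalAPacketMembers                         -- ★ `Gqs L v = U(Φ₃)(L⁺_v)` (the (E1b) carrier), `qsForm`
import HarnessLib

/-!
# F0 · P3c · line LH6 «StCharTS» — road «JAC-ELL» brick (Q9-CM): THE DOCKING LINE OF THE LOCAL TUBE-JACOBIAN SOCKET AT THE ONE-PLACE MODEL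
# `e = localNonsplitEquiv : U(J)(F_v) ≃ₜ* U(σ_w, J_w)(E_w)` (Harish-Chandra 1970 Lemma 22; Platonov–Rapinchuk 1994 §5.1)

Cell `pub/hodgecm-mathlib`, crux H413 = `stmt-HodgeConjecture-24833` (lane `--supports`, helper); seat A-p12 (g29); brick (Q9-CM) of the road «JAC-ELL» (LH5-p02 (g6),
«=» 2026-09-02T15:59:33Z).  THEOREMS ONLY; sorry-free; no definition ∕ instance ∕ notation ∕ named fact; axioms TRIO.

WHAT.  ★ (Q9) `…TubeJacobianTransport` moves the LOCAL TUBE-JACOBIAN SOCKET `hJacLoc` (★ p851645 ∕ ★ (E1b) `…WeylCartanJacobian` :85–:94) along any homeomorphic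
group isomorphism once three compatibilities `hTT'`, `hΦΦ'`, `hPP'` are supplied.  This file DISCHARGES them at the one-place model of a unitary group at a NON-SPLIT
place, `e := localNonsplitEquiv c J hc w hw : «local» E c N J v ≃ₜ* ↥(unitaryGroupOfForm σ_w J_w)` (`σ_w = galAdicCompletionMap c hw`, `J_w = placeForm J w`):
* `hTT'` — `e g ∈ Z(e γ₀) ↔ g ∈ Z(γ₀)` (centralisers correspond; `T = Z(γ₀)` read as `hT : T = Subgroup.centralizer {γ₀}` on the `F_v`-side as (E1b) prints it,
  and as the membership description `hT' : ∀ g', g' ∈ T' ↔ g' * e γ₀ = e γ₀ * g'` on the model side as ★ C4m prints it);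
* `hPP'` — regularity `IsRegularElt` (separable characteristic polynomial, ★ `LocalTransfer`) corresponds: ★ `isRegularElt_iff_charpoly_separable_localNonsplitEquiv`;
* `hΦΦ'` — the conjugation families correspond: ★ (Q9) `map_conjFamily_eq_conjFamily`.

HEADS.
* **`tubeJacobianLocal_local_of_model`** — socket on the MODEL for the transported Haar data `(ν', tm')` with `ν' = e_* ν`, `tm' = (e|_T)_* tm` ⇒ socket on
  `U(J)(F_v)` for `(ν, tm)` (★ (Q9) `tubeJacobianLocal_of_mulEquiv_map_nnreal` with the three compatibilities discharged; weights `D`, `D'` with `D' ∘ e|_T = D`).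
* **`tubeJacobianLocal_local_of_forall_model`** — the same with the model socket quantified over ALL Haar data `(ν', tm')` carrying the socket's instance classes
  (the shape of the model theorem C8b): the instances at `(e_* ν, (e|_T)_* tm)` are supplied here from ★ (Q9)'s §1 kit, so the datum-side socket (at
  `Gqs L v = «local» L c̄ 3 Φ₃ v`) follows by ONE `exact`.
* **`tubeJacobianLocal_Gqs_of_forall_model`** (§3) — the same READ ON THE CM CARRIER `Gqs L v = U(Φ₃)(L⁺_v)` in (E1b)'s tokens (the `Gqs`-typed instances passed by
  name, as ★ `…CartanNullDischarge` does), so that (E1b)'s `hJacLoc` is literally its conclusion.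

HONEST LABEL: count-neutral; closes no organ (it docks the model computation C8b into (E1b)'s `hJacLoc`; it does not compute the Jacobian).  HC_CM is proved
only modulo the 7 printed citations (2 remaining: hLiu418 = `stmt-HodgeConjecture-24832`, h413 = `stmt-HodgeConjecture-24833`) until rung 0 closes.

## References
* [HarishChandra1970] Harish-Chandra (notes by G. van Dijk), *Harmonic analysis on reductive p-adic groups*, LNM 162 (1970), Part V §4 Lemma 22.
* [PlatonovRapinchuk1994] V. Platonov, A. Rapinchuk, *Algebraic Groups and Number Theory* (1994), §5.1 (`G_{F_v}` of a matrix realisation; the one-place model).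
-/

set_option autoImplicit false
-- the mandated namespace has the single-problem summit's repeated segment (`HodgeConjecture.HodgeConjecture`)
set_option linter.dupNamespace false

noncomputable section

open MeasureTheory Measure Set Filter Topology Function NumberField IsDedekindDomain
open Literature.MeasureTheory.Group
open Literature.NumberTheory.Automorphic Literature.NumberTheory.Automorphic.UnitaryGroup
open Literature.NumberTheory.Rogawski1990 (IsRegularElt isRegularElt_iff)
open Summit.HodgeConjecture.HodgeConjecture.Cruxes.H413.F0P3cStCharTSTubeJacobianTransport
open scoped ENNReal NNReal MatrixGroups Pointwise

namespace Summit.HodgeConjecture.HodgeConjecture.Cruxes.H413.F0P3cStCharTSTubeJacobianTransportNonsplit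

section Nonsplit

variable {F E : Type} [Field F] [NumberField F] [Field E] [NumberField E] [Algebra F E] [Algebra.IsQuadraticExtension F E]
  (c : E ≃ₐ[F] E) (N : ℕ) (J : Matrix (Fin N) (Fin N) E) {v : HeightOneSpectrum (𝓞 F)} (hc : c ≠ 1)
  (w : PlacesOver E v) (hw : c • w.1 = w.1)
  {γ₀ : ↥(«local» E c N J v)} {T : Subgroup ↥(«local» E c N J v)} (hT : T = Subgroup.centralizer ({γ₀} : Set ↥(«local» E c N J v)))
  {T' : Subgroup ↥(unitaryGroupOfForm (galAdicCompletionMap (L := E) c hw) (placeForm J w.1))}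
  (hT' : ∀ g', g' ∈ T' ↔ g' * localNonsplitEquiv c J hc w hw γ₀ = localNonsplitEquiv c J hc w hw γ₀ * g')

/-! ## §1 The three compatibilities at `e = localNonsplitEquiv` -/

include hT hT' in
/-- The centralisers correspond under `e = localNonsplitEquiv`: `e g ∈ T' = Z(e γ₀) ↔ g ∈ T = Z(γ₀)`. [cite: PlatonovRapinchuk1994, §5.1] -/
theorem localNonsplitEquiv_mem_iff (g : ↥(«local» E c N J v)) : (localNonsplitEquiv c J hc w hw).toMulEquiv g ∈ T' ↔ g ∈ T := by
  rw [hT', hT, Subgroup.mem_centralizer_iff]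
  simp only [Set.mem_singleton_iff, forall_eq]
  change localNonsplitEquiv c J hc w hw g * _ = _ * localNonsplitEquiv c J hc w hw g ↔ _
  rw [← map_mul, ← map_mul, (localNonsplitEquiv c J hc w hw).injective.eq_iff]
  exact ⟨fun h => h.symm, fun h => h.symm⟩

include hw in
/-- Regularity corresponds under `e = localNonsplitEquiv` (★ `isRegularElt_iff_charpoly_separable_localNonsplitEquiv`; `IsRegularElt` IS separability of the
characteristic polynomial, ★ `isRegularElt_iff`). [cite: PlatonovRapinchuk1994, §5.1] -/
theorem isRegularElt_localNonsplitEquiv_iff (g : ↥(«local» E c N J v)) :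
    IsRegularElt (((localNonsplitEquiv c J hc w hw).toMulEquiv g :
        ↥(unitaryGroupOfForm (galAdicCompletionMap (L := E) c hw) (placeForm J w.1))) : GL (Fin N) (w.1.adicCompletion E)) ↔
      IsRegularElt ((g : ↥(«local» E c N J v)) : GL (Fin N) (LocalRing E v)) := by
  rw [isRegularElt_iff, isRegularElt_iff_charpoly_separable_localNonsplitEquiv c N J hc w hw g]
  rfl

/-! ## §2 The docking line -/

section Socket

variable
  -- the `F_v`-side: `G = U(J)(F_v)`, `T = Z(γ₀)`
  [MeasurableSpace ↥(«local» E c N J v)] [BorelSpace ↥(«local» E c N J v)] [LocallyCompactSpace ↥(«local» E c N J v)]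
  [SecondCountableTopology ↥(«local» E c N J v)] [T2Space ↥(«local» E c N J v)]
  (hTc : IsClosed (T : Set ↥(«local» E c N J v)))
  [MeasurableSpace (↥(«local» E c N J v) ⧸ T)] [BorelSpace (↥(«local» E c N J v) ⧸ T)]
  (ν : Measure ↥(«local» E c N J v)) [ν.IsHaarMeasure] [ν.IsMulRightInvariant]
  (tm : Measure ↥T) [tm.IsMulLeftInvariant] [IsFiniteMeasureOnCompacts tm] [tm.IsOpenPosMeasure] [tm.IsInvInvariant]
  (Φ : (↥(«local» E c N J v) ⧸ T) × ↥T → ↥(«local» E c N J v))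
  (hΦ : ∀ (x : ↥(«local» E c N J v)) (t : ↥T), Φ (QuotientGroup.mk x, t) = x * t * x⁻¹)
  (D : ↥T → ℝ≥0)
  -- the model side: `G' = U(σ_w, J_w)(E_w)`, `T' = Z(e γ₀)`
  [MeasurableSpace ↥(unitaryGroupOfForm (galAdicCompletionMap (L := E) c hw) (placeForm J w.1))]
  [BorelSpace ↥(unitaryGroupOfForm (galAdicCompletionMap (L := E) c hw) (placeForm J w.1))]
  [LocallyCompactSpace ↥(unitaryGroupOfForm (galAdicCompletionMap (L := E) c hw) (placeForm J w.1))]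
  [SecondCountableTopology ↥(unitaryGroupOfForm (galAdicCompletionMap (L := E) c hw) (placeForm J w.1))]
  [T2Space ↥(unitaryGroupOfForm (galAdicCompletionMap (L := E) c hw) (placeForm J w.1))]
  (hT'c : IsClosed (T' : Set ↥(unitaryGroupOfForm (galAdicCompletionMap (L := E) c hw) (placeForm J w.1))))
  [MeasurableSpace (↥(unitaryGroupOfForm (galAdicCompletionMap (L := E) c hw) (placeForm J w.1)) ⧸ T')]
  [BorelSpace (↥(unitaryGroupOfForm (galAdicCompletionMap (L := E) c hw) (placeForm J w.1)) ⧸ T')]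
  (Φ' : (↥(unitaryGroupOfForm (galAdicCompletionMap (L := E) c hw) (placeForm J w.1)) ⧸ T') × ↥T' →
    ↥(unitaryGroupOfForm (galAdicCompletionMap (L := E) c hw) (placeForm J w.1)))
  (hΦ' : ∀ (y : ↥(unitaryGroupOfForm (galAdicCompletionMap (L := E) c hw) (placeForm J w.1))) (t' : ↥T'), Φ' (QuotientGroup.mk y, t') = y * t' * y⁻¹)
  (D' : ↥T' → ℝ≥0)

include hT hT' hΦ hΦ' hw in
/-- **THE DOCKING LINE AT THE ONE-PLACE MODEL** (`e = localNonsplitEquiv`, `T = Z(γ₀)`, `T' = Z(e γ₀)`, conjugation families `Φ`, `Φ'`, weights `D' ∘ e|_T = D`): if the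
local tube-Jacobian socket holds on the MODEL `U(σ_w, J_w)(E_w)` for the transported Haar data `ν' = e_* ν`, `tm' = (e|_T)_* tm`, then it holds on `U(J)(F_v)` for
`(ν, tm)` — ★ (Q9) `tubeJacobianLocal_of_mulEquiv_map_nnreal` with `hTT'` (`localNonsplitEquiv_mem_iff`), `hPP'` (`isRegularElt_localNonsplitEquiv_iff`) and `hΦΦ'`
(★ `map_conjFamily_eq_conjFamily`) discharged. [cite: HarishChandra1970, Lemma 22] [cite: PlatonovRapinchuk1994, §5.1] -/
theorem tubeJacobianLocal_local_of_model
    (ν' : Measure ↥(unitaryGroupOfForm (galAdicCompletionMap (L := E) c hw) (placeForm J w.1))) [ν'.IsHaarMeasure] [ν'.IsMulRightInvariant]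
    (tm' : Measure ↥T') [tm'.IsMulLeftInvariant] [IsFiniteMeasureOnCompacts tm'] [tm'.IsOpenPosMeasure] [tm'.IsInvInvariant]
    (hν' : ν' = Measure.map (localNonsplitEquiv c J hc w hw) ν)
    (htm' : tm' = Measure.map (subgroupCongrHomeomorph (localNonsplitEquiv c J hc w hw).toMulEquiv T T' (localNonsplitEquiv_mem_iff c N J hc w hw hT hT')
      (localNonsplitEquiv c J hc w hw).continuous (localNonsplitEquiv c J hc w hw).symm.continuous) tm)
    (hDD' : ∀ (t : ↥T) (h : (localNonsplitEquiv c J hc w hw).toMulEquiv t ∈ T'), D' ⟨(localNonsplitEquiv c J hc w hw).toMulEquiv t, h⟩ = D t)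
    (hJacLoc' : ∀ t₀ : ↥T', IsRegularElt (((t₀ : ↥(unitaryGroupOfForm (galAdicCompletionMap (L := E) c hw) (placeForm J w.1)))) : GL (Fin N) (w.1.adicCompletion E)) →
      ∃ U : Set ↥T', IsOpen U ∧ t₀ ∈ U ∧
        ∃ A₀ : Set (↥(unitaryGroupOfForm (galAdicCompletionMap (L := E) c hw) (placeForm J w.1)) ⧸ T'), MeasurableSet A₀ ∧
          (quotientMeasure T' tm' hT'c ν') A₀ ≠ 0 ∧ (quotientMeasure T' tm' hT'c ν') A₀ ≠ ∞ ∧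
          ∀ V : Set ↥T', MeasurableSet V → V ⊆ U →
            (∀ t ∈ V, IsRegularElt (((t : ↥(unitaryGroupOfForm (galAdicCompletionMap (L := E) c hw) (placeForm J w.1)))) : GL (Fin N) (w.1.adicCompletion E))) →
            (∀ n : ↥(unitaryGroupOfForm (galAdicCompletionMap (L := E) c hw) (placeForm J w.1)), n ∉ T' → ∀ t ∈ V, ∀ t' ∈ V,
                ((t' : ↥T') : ↥(unitaryGroupOfForm (galAdicCompletionMap (L := E) c hw) (placeForm J w.1))) ≠ n * t * n⁻¹) →
              ν' (Φ' '' (A₀ ×ˢ V)) = (quotientMeasure T' tm' hT'c ν') A₀ * ∫⁻ t in V, (D' t : ℝ≥0∞) ∂tm') :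
    ∀ t₀ : ↥T, IsRegularElt (((t₀ : ↥(«local» E c N J v))) : GL (Fin N) (LocalRing E v)) →
      ∃ U : Set ↥T, IsOpen U ∧ t₀ ∈ U ∧
        ∃ A₀ : Set (↥(«local» E c N J v) ⧸ T), MeasurableSet A₀ ∧ (quotientMeasure T tm hTc ν) A₀ ≠ 0 ∧
          (quotientMeasure T tm hTc ν) A₀ ≠ ∞ ∧
          ∀ V : Set ↥T, MeasurableSet V → V ⊆ U → (∀ t ∈ V, IsRegularElt (((t : ↥(«local» E c N J v))) : GL (Fin N) (LocalRing E v))) →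
            (∀ n : ↥(«local» E c N J v), n ∉ T → ∀ t ∈ V, ∀ t' ∈ V, ((t' : ↥T) : ↥(«local» E c N J v)) ≠ n * t * n⁻¹) →
              ν (Φ '' (A₀ ×ˢ V)) = (quotientMeasure T tm hTc ν) A₀ * ∫⁻ t in V, (D t : ℝ≥0∞) ∂tm := by
  set e := localNonsplitEquiv c J hc w hw with he
  exact tubeJacobianLocal_of_mulEquiv_map_nnreal e.toMulEquiv e.continuous e.symm.continuous T hTc T' hT'c
    (localNonsplitEquiv_mem_iff c N J hc w hw hT hT') ν ν' tm tm' hν' htm' Φ Φ'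
    (map_conjFamily_eq_conjFamily e.toMulEquiv e.continuous e.symm.continuous T T' (localNonsplitEquiv_mem_iff c N J hc w hw hT hT') Φ hΦ Φ' hΦ')
    (fun g => IsRegularElt ((g : ↥(«local» E c N J v)) : GL (Fin N) (LocalRing E v)))
    (fun g' => IsRegularElt ((g' : ↥(unitaryGroupOfForm (galAdicCompletionMap (L := E) c hw) (placeForm J w.1))) : GL (Fin N) (w.1.adicCompletion E)))
    (fun g => isRegularElt_localNonsplitEquiv_iff c N J hc w hw g) D D' (fun t => hDD' t _) hJacLoc'

include hT hT' hΦ hΦ' hw in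
/-- **THE DOCKING LINE, MODEL SOCKET QUANTIFIED OVER ALL HAAR DATA** (the shape of the model computation C8b): if the local tube-Jacobian socket holds on the MODEL
`U(σ_w, J_w)(E_w)` at `T' = Z(e γ₀)` for EVERY `ν'` (`IsHaarMeasure`, `IsMulRightInvariant`) and EVERY `tm'` (`IsMulLeftInvariant`, `IsFiniteMeasureOnCompacts`,
`IsOpenPosMeasure`, `IsInvInvariant`), then it holds on `U(J)(F_v)` at `T = Z(γ₀)` for the given `(ν, tm)` — the instance classes of `(e_* ν, (e|_T)_* tm)` come from
★ (Q9) §1 (`isHaarMeasure_map_mulEquiv`, `isMulRightInvariant_map_mulEquiv`, `isMulLeftInvariant_map_subgroupCongr`, `isFiniteMeasureOnCompacts_map_subgroupCongr`,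
`isOpenPosMeasure_map_subgroupCongr`, `isInvInvariant_map_subgroupCongr`).  At the CM datum (`E := L`, `c := complexConj`, `N := 3`, `J := Φ₃`, so that
`«local» … v = Gqs L v`) the conclusion IS (E1b)'s `hJacLoc`. [cite: HarishChandra1970, Lemma 22] [cite: PlatonovRapinchuk1994, §5.1] -/
theorem tubeJacobianLocal_local_of_forall_model
    (hDD' : ∀ (t : ↥T) (h : (localNonsplitEquiv c J hc w hw).toMulEquiv t ∈ T'), D' ⟨(localNonsplitEquiv c J hc w hw).toMulEquiv t, h⟩ = D t)
    (hmodel : ∀ (ν' : Measure ↥(unitaryGroupOfForm (galAdicCompletionMap (L := E) c hw) (placeForm J w.1))) [ν'.IsHaarMeasure] [ν'.IsMulRightInvariant]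
      (tm' : Measure ↥T') [tm'.IsMulLeftInvariant] [IsFiniteMeasureOnCompacts tm'] [tm'.IsOpenPosMeasure] [tm'.IsInvInvariant],
      ∀ t₀ : ↥T', IsRegularElt (((t₀ : ↥(unitaryGroupOfForm (galAdicCompletionMap (L := E) c hw) (placeForm J w.1)))) : GL (Fin N) (w.1.adicCompletion E)) →
        ∃ U : Set ↥T', IsOpen U ∧ t₀ ∈ U ∧
          ∃ A₀ : Set (↥(unitaryGroupOfForm (galAdicCompletionMap (L := E) c hw) (placeForm J w.1)) ⧸ T'), MeasurableSet A₀ ∧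
            (quotientMeasure T' tm' hT'c ν') A₀ ≠ 0 ∧ (quotientMeasure T' tm' hT'c ν') A₀ ≠ ∞ ∧
            ∀ V : Set ↥T', MeasurableSet V → V ⊆ U →
              (∀ t ∈ V, IsRegularElt (((t : ↥(unitaryGroupOfForm (galAdicCompletionMap (L := E) c hw) (placeForm J w.1)))) : GL (Fin N) (w.1.adicCompletion E))) →
              (∀ n : ↥(unitaryGroupOfForm (galAdicCompletionMap (L := E) c hw) (placeForm J w.1)), n ∉ T' → ∀ t ∈ V, ∀ t' ∈ V,
                  ((t' : ↥T') : ↥(unitaryGroupOfForm (galAdicCompletionMap (L := E) c hw) (placeForm J w.1))) ≠ n * t * n⁻¹) →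
                ν' (Φ' '' (A₀ ×ˢ V)) = (quotientMeasure T' tm' hT'c ν') A₀ * ∫⁻ t in V, (D' t : ℝ≥0∞) ∂tm') :
    ∀ t₀ : ↥T, IsRegularElt (((t₀ : ↥(«local» E c N J v))) : GL (Fin N) (LocalRing E v)) →
      ∃ U : Set ↥T, IsOpen U ∧ t₀ ∈ U ∧
        ∃ A₀ : Set (↥(«local» E c N J v) ⧸ T), MeasurableSet A₀ ∧ (quotientMeasure T tm hTc ν) A₀ ≠ 0 ∧
          (quotientMeasure T tm hTc ν) A₀ ≠ ∞ ∧
          ∀ V : Set ↥T, MeasurableSet V → V ⊆ U → (∀ t ∈ V, IsRegularElt (((t : ↥(«local» E c N J v))) : GL (Fin N) (LocalRing E v))) →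
            (∀ n : ↥(«local» E c N J v), n ∉ T → ∀ t ∈ V, ∀ t' ∈ V, ((t' : ↥T) : ↥(«local» E c N J v)) ≠ n * t * n⁻¹) →
              ν (Φ '' (A₀ ×ˢ V)) = (quotientMeasure T tm hTc ν) A₀ * ∫⁻ t in V, (D t : ℝ≥0∞) ∂tm := by
  set e := localNonsplitEquiv c J hc w hw with he
  have hTT' := localNonsplitEquiv_mem_iff c N J hc w hw hT hT'
  set eT := subgroupCongrHomeomorph e.toMulEquiv T T' hTT' e.continuous e.symm.continuous with heT
  -- the instance classes of the transported Haar data (★ (Q9) §1)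
  haveI : (Measure.map (⇑e.toMulEquiv) ν).IsHaarMeasure := isHaarMeasure_map_mulEquiv e.toMulEquiv e.continuous e.symm.continuous ν
  haveI : (Measure.map (⇑e.toMulEquiv) ν).IsMulRightInvariant := isMulRightInvariant_map_mulEquiv e.toMulEquiv e.continuous.measurable ν
  haveI : (Measure.map eT tm).IsMulLeftInvariant := isMulLeftInvariant_map_subgroupCongr e.toMulEquiv e.continuous e.symm.continuous T T' hTT' tm
  haveI : IsFiniteMeasureOnCompacts (Measure.map eT tm) := isFiniteMeasureOnCompacts_map_subgroupCongr e.toMulEquiv e.continuous e.symm.continuous T T' hTT' tm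
  haveI : (Measure.map eT tm).IsOpenPosMeasure := isOpenPosMeasure_map_subgroupCongr e.toMulEquiv e.continuous e.symm.continuous T T' hTT' tm
  haveI : (Measure.map eT tm).IsInvInvariant := isInvInvariant_map_subgroupCongr e.toMulEquiv e.continuous e.symm.continuous T T' hTT' tm
  exact tubeJacobianLocal_local_of_model c N J hc w hw hT hT' hTc ν tm Φ hΦ D hT'c Φ' hΦ' D' (Measure.map (⇑e.toMulEquiv) ν) (Measure.map eT tm) rfl rfl
    hDD' (hmodel _ _)

end Socket

end Nonsplit


/-! ## §3 At the CM datum `G = Gqs L v = U(Φ₃)(L⁺_v)` — (E1b)'s carrier, token for token -/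

section CM

open Literature.NumberTheory.Rogawski1990 (Gqs qsForm)

variable {L : Type} [Field L] [NumberField L] [IsCMField L] {v : HeightOneSpectrum (𝓞 ↥(maximalRealSubfield L))}
  {T : Subgroup (Gqs L v)} {γ₀ : Gqs L v}
  (hT : T = Subgroup.centralizer ({γ₀} : Set (Gqs L v)))
  (Φ : (Gqs L v ⧸ T) × ↥T → Gqs L v) (hΦ : ∀ (x : Gqs L v) (t : ↥T), Φ (QuotientGroup.mk x, t) = x * t * x⁻¹)
  [instM : MeasurableSpace (Gqs L v)] [instB : BorelSpace (Gqs L v)] [instLC : LocallyCompactSpace (Gqs L v)] [instSC : SecondCountableTopology (Gqs L v)]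
  [instT2 : T2Space (Gqs L v)] (hTc : IsClosed (T : Set (Gqs L v)))
  [instQM : MeasurableSpace (Gqs L v ⧸ T)] [instQB : BorelSpace (Gqs L v ⧸ T)]
  (ν : Measure (Gqs L v)) [instν₁ : ν.IsHaarMeasure] [instν₂ : ν.IsMulRightInvariant]
  (tm : Measure ↥T) [instt₁ : tm.IsMulLeftInvariant] [instt₂ : IsFiniteMeasureOnCompacts tm] [instt₃ : tm.IsOpenPosMeasure] [instt₄ : tm.IsInvInvariant]
  (D : ↥T → ℝ≥0)
  (w : PlacesOver L v) (hw : IsCMField.complexConj L • w.1 = w.1)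
  -- the one-place model `U(σ_w, Φ₃)(L_w)` and `T' = Z(e γ₀)`
  [MeasurableSpace ↥(unitaryGroupOfForm (galAdicCompletionMap (L := L) (IsCMField.complexConj L) hw) (placeForm (qsForm L) w.1))]
  [BorelSpace ↥(unitaryGroupOfForm (galAdicCompletionMap (L := L) (IsCMField.complexConj L) hw) (placeForm (qsForm L) w.1))]
  [LocallyCompactSpace ↥(unitaryGroupOfForm (galAdicCompletionMap (L := L) (IsCMField.complexConj L) hw) (placeForm (qsForm L) w.1))]
  [SecondCountableTopology ↥(unitaryGroupOfForm (galAdicCompletionMap (L := L) (IsCMField.complexConj L) hw) (placeForm (qsForm L) w.1))]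
  [T2Space ↥(unitaryGroupOfForm (galAdicCompletionMap (L := L) (IsCMField.complexConj L) hw) (placeForm (qsForm L) w.1))]
  {T' : Subgroup ↥(unitaryGroupOfForm (galAdicCompletionMap (L := L) (IsCMField.complexConj L) hw) (placeForm (qsForm L) w.1))}
  (hT' : ∀ g', g' ∈ T' ↔ g' * localNonsplitEquiv (IsCMField.complexConj L) (qsForm L) (IsCMField.complexConj_ne_one L) w hw γ₀ =
    localNonsplitEquiv (IsCMField.complexConj L) (qsForm L) (IsCMField.complexConj_ne_one L) w hw γ₀ * g')
  (hT'c : IsClosed (T' : Set ↥(unitaryGroupOfForm (galAdicCompletionMap (L := L) (IsCMField.complexConj L) hw) (placeForm (qsForm L) w.1))))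
  [MeasurableSpace (↥(unitaryGroupOfForm (galAdicCompletionMap (L := L) (IsCMField.complexConj L) hw) (placeForm (qsForm L) w.1)) ⧸ T')]
  [BorelSpace (↥(unitaryGroupOfForm (galAdicCompletionMap (L := L) (IsCMField.complexConj L) hw) (placeForm (qsForm L) w.1)) ⧸ T')]
  (Φ' : (↥(unitaryGroupOfForm (galAdicCompletionMap (L := L) (IsCMField.complexConj L) hw) (placeForm (qsForm L) w.1)) ⧸ T') × ↥T' →
    ↥(unitaryGroupOfForm (galAdicCompletionMap (L := L) (IsCMField.complexConj L) hw) (placeForm (qsForm L) w.1)))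
  (hΦ' : ∀ (y : ↥(unitaryGroupOfForm (galAdicCompletionMap (L := L) (IsCMField.complexConj L) hw) (placeForm (qsForm L) w.1))) (t' : ↥T'),
    Φ' (QuotientGroup.mk y, t') = y * t' * y⁻¹)
  (D' : ↥T' → ℝ≥0)

include hT hΦ hT' hΦ' in
/-- **THE DOCKING LINE AT THE CM DATUM, IN (E1b)'s TOKENS** (`G = Gqs L v = U(Φ₃)(L⁺_v)`, `v` non-split with `w ∣ v` fixed by `c̄`, `T = Z(γ₀)`,
`e = localNonsplitEquiv c̄ Φ₃ … w hw`, `T' = Z(e γ₀)`): if the local tube-Jacobian socket holds on the MODEL `U(σ_w, Φ₃)(L_w)` at `T'` for EVERY Haar datum `(ν', tm')`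
with the socket's instance classes, with weights `D' ∘ e|_T = D`, then (E1b)'s hypothesis `hJacLoc` (★ `…WeylCartanJacobian.lintegral_cartanSet_eq_of_tubeJacobian_local`,
:85–:94, `quotientMeasure T tm _ ν` read with ANY closedness witness) holds at `(ν, tm)` — `tubeJacobianLocal_local_of_forall_model` read on the `Gqs` carrier
(definitionally the matrix carrier; the `Gqs`-typed instances are passed by name). [cite: HarishChandra1970, Lemma 22] [cite: PlatonovRapinchuk1994, §5.1] -/
theorem tubeJacobianLocal_Gqs_of_forall_model
    (hDD' : ∀ (t : ↥T) (h : (localNonsplitEquiv (IsCMField.complexConj L) (qsForm L) (IsCMField.complexConj_ne_one L) w hw).toMulEquiv (t : Gqs L v) ∈ T'),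
      D' ⟨(localNonsplitEquiv (IsCMField.complexConj L) (qsForm L) (IsCMField.complexConj_ne_one L) w hw).toMulEquiv (t : Gqs L v), h⟩ = D t)
    (hmodel : ∀ (ν' : Measure ↥(unitaryGroupOfForm (galAdicCompletionMap (L := L) (IsCMField.complexConj L) hw) (placeForm (qsForm L) w.1)))
      [ν'.IsHaarMeasure] [ν'.IsMulRightInvariant]
      (tm' : Measure ↥T') [tm'.IsMulLeftInvariant] [IsFiniteMeasureOnCompacts tm'] [tm'.IsOpenPosMeasure] [tm'.IsInvInvariant],
      ∀ t₀ : ↥T', IsRegularElt (((t₀ : ↥(unitaryGroupOfForm (galAdicCompletionMap (L := L) (IsCMField.complexConj L) hw) (placeForm (qsForm L) w.1)))) :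
          GL (Fin 3) (w.1.adicCompletion L)) →
        ∃ U : Set ↥T', IsOpen U ∧ t₀ ∈ U ∧
          ∃ A₀ : Set (↥(unitaryGroupOfForm (galAdicCompletionMap (L := L) (IsCMField.complexConj L) hw) (placeForm (qsForm L) w.1)) ⧸ T'), MeasurableSet A₀ ∧
            (quotientMeasure T' tm' hT'c ν') A₀ ≠ 0 ∧ (quotientMeasure T' tm' hT'c ν') A₀ ≠ ∞ ∧
            ∀ V : Set ↥T', MeasurableSet V → V ⊆ U →
              (∀ t ∈ V, IsRegularElt (((t : ↥(unitaryGroupOfForm (galAdicCompletionMap (L := L) (IsCMField.complexConj L) hw) (placeForm (qsForm L) w.1)))) :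
                  GL (Fin 3) (w.1.adicCompletion L))) →
              (∀ n : ↥(unitaryGroupOfForm (galAdicCompletionMap (L := L) (IsCMField.complexConj L) hw) (placeForm (qsForm L) w.1)), n ∉ T' → ∀ t ∈ V, ∀ t' ∈ V,
                  ((t' : ↥T') : ↥(unitaryGroupOfForm (galAdicCompletionMap (L := L) (IsCMField.complexConj L) hw) (placeForm (qsForm L) w.1))) ≠ n * t * n⁻¹) →
                ν' (Φ' '' (A₀ ×ˢ V)) = (quotientMeasure T' tm' hT'c ν') A₀ * ∫⁻ t in V, (D' t : ℝ≥0∞) ∂tm') :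
    ∀ t₀ : ↥T, IsRegularElt (((t₀ : Gqs L v)).val : GL (Fin 3) (LocalRing L v)) →
      ∃ U : Set ↥T, IsOpen U ∧ t₀ ∈ U ∧
        ∃ A₀ : Set (Gqs L v ⧸ T), MeasurableSet A₀ ∧ (quotientMeasure T tm hTc ν) A₀ ≠ 0 ∧
          (quotientMeasure T tm hTc ν) A₀ ≠ ∞ ∧
          ∀ V : Set ↥T, MeasurableSet V → V ⊆ U → (∀ t ∈ V, IsRegularElt (((t : Gqs L v)).val : GL (Fin 3) (LocalRing L v))) →
            (∀ n : Gqs L v, n ∉ T → ∀ t ∈ V, ∀ t' ∈ V, ((t' : ↥T) : Gqs L v) ≠ n * t * n⁻¹) →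
              ν (Φ '' (A₀ ×ˢ V)) = (quotientMeasure T tm hTc ν) A₀ * ∫⁻ t in V, (D t : ℝ≥0∞) ∂tm :=
  @tubeJacobianLocal_local_of_forall_model _ _ _ _ _ _ _ _ (IsCMField.complexConj L) 3 (qsForm L) _ (IsCMField.complexConj_ne_one L) w hw γ₀ T hT T' hT'
    instM instB instLC instSC instT2 hTc instQM instQB ν instν₁ instν₂ tm instt₁ instt₂ instt₃ instt₄ Φ hΦ D _ _ _ _ _ hT'c _ _ Φ' hΦ' D' hDD' hmodel

end CM

end Summit.HodgeConjecture.HodgeConjecture.Cruxes.H413.F0P3cStCharTSTubeJacobianTransportNonsplit
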